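/-
Copyright (c) 2026 the pub-hodgecm-mathlib formalisation cell (harness21).  Prover seat hodgecm-mathlib-LH4-p07 (g9), req620 Track A «(D-RAM) FOUR-FRAME» squad
(STAGE-1b, row-(2) lineage; dealer LH4-plan (g13) WORD #58 RULING A ∕ #59 ∕ #64 ∕ #65 ∕ #69 (4): owner of the two-literal census law of `lev_{a,m}`), 2026-09-04.
-/
import Summits.HodgeConjecture.HodgeConjecture.Theorems.F0P3cDyRamLevelsCensusGuardedCM          -- ★ p859485 (LH4-p04 (g7)): §1 `…_levels_eq_guardedForm`, §2 `…_conj_endoGL_levels_eq_guardedForm` (generic guard)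
import Summits.HodgeConjecture.HodgeConjecture.Theorems.F0P3cDyRamToricLevelCensusRamMTwoMult       -- ★ p858944 (LH4-p04): `finsum_mem_inter_levelSetDep_eq_ramified` (ramified two-multiplier cell)
import Summits.HodgeConjecture.HodgeConjecture.Theorems.F0P3cDyRamJointProfileCensusCutoff        -- ★ p859713 (this seat): `guard_iff_cutoff_unr`, `add_sub_two_sub_map_eq`, `v_sub_map_le`; brings GUARD LETTER + axis tables
import HarnessLib

/-!
# Crux `H413`, line LH4 «(D-RAM) FOUR-FRAME» — STAGE-1b, row (2): (C2-lev-cutoff-CM-RamM) «THE LEVEL-PIECE CENSUS AT THE CM PLACE AS A DOUBLY TRUNCATED ORDER FORM» (type RamM)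
# `cnt_{a,b}(Γ) = Σ_{j ≤ jl − a} #levelSet(j, 0) + Σ_{b′ ∈ Icc 1 R} Σ_{j ≤ jl − a} [j + b′ ≤ m₂ ∨ 2(j + b′) + kν ≤ 2m₂ + 2jl]·Σᶠ_{Λ ∈ levelSetDep(j, b′; μ₁)} f b′ j Λ`

Cell `hodgecm-mathlib` (D-0151), FLOOR 0, crux item H413 = `stmt-HodgeConjecture-24833`, route of record `HCCMUnconditional`; squad F0∕P3c∕LH4; lane
`--supports stmt-HodgeConjecture-24833 --as helper` (count-neutral; pays NO tier-0 row).  THEOREMS ONLY (no `def`, no instance, no notation, no `sorry`, default heartbeats).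
OWNER'S ORGAN №15 — the RamM-lane twin of ★ p860083: ★ p859713 §Ramified READ AT THE CM PLACE through ★ p859485 §1∕§2 (generic guard) with `hcell :=` ★ p858944.
* §0 `sum_ite_isOrd₃_eq_sum_range_of_deep'` — ★ p860083 §0 made LANE-FREE: the finite trace token is supplied by a witness hypothesis `hxpow` (at the CM place: `hEval` on the
  `ρ`-fixed element `lam + ρlam − 2`) instead of `|jEϖ| = exp(−1)`, so it serves the ramified letter `|jEϖ| = exp(−2)` as well (case `lam + ρlam = 2` included).
* §1 **`ncard_typeZero_fixed_endoGL_levels_eq_cutoff_ramM`** (hyperbolic literal) ∕ §2 **`ncard_typeZero_fixed_conj_endoGL_levels_eq_cutoff_ramM`** (anisotropic literal): ★ p859485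
  §1∕§2's binders VERBATIM (universe-0 `M`) + the ramified datum `IsRamifiedQuadraticDatum ρ α d_ρ t_ρ` on `M`, `|jEϖ| = exp(−2)`, multiplier tokens `|μ₁| = |jEϖ|^{m₁}`,
  `|μ₂| = |jEϖ|^{m₂}`, `m₁ ≤ m₂`, the tokens `jl, kν` (`|lam + jE u₀₀ − 2| = exp(−kν)`), the deep trace letter and the level letters ⊢ rows `j ≤ jl − a`, cone guard
  `j + b′ ≤ m₂ ∨ 2(j + b′) + kν ≤ 2m₂ + 2jl` (★ p859341 GUARD LETTER ∘ ★ `guard_iff_cutoff_ramM`, `|α − ρα| = exp(−d_ρ)` by ★ `v_sub_map_eq_exp_of_datum`).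
Consumer: the RamM level socket `levelsCensusC` (frame = ★ `orderCountCensusC`'s).  HONEST LABEL.  Count-neutral lattice bookkeeping; no census law is stated; `HC_CM` is proved only
modulo the 7 printed citations (2 remaining named inputs: hLiu418 = `stmt-HodgeConjecture-24832`, h413 = `stmt-HodgeConjecture-24833`) until rung 0 closes.

## References
* [Kottwitz1986BaseChangeUnits] R. E. Kottwitz, *Base change for unit elements of Hecke algebras*, Compositio Math. 60 (1986): §1 pp. 240–241.
* [Rogawski1990] J. D. Rogawski, *Automorphic Representations of Unitary Groups in Three Variables*, Ann. of Math. Stud. 123 (1990): §4.3 p. 43; §4.9 Prop. 4.9.1 (a)(b) pp. 54–55, Lemma 4.9.3 p. 56.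
* [Jacobowitz1962] R. Jacobowitz, *Hermitian forms over local fields*, Amer. J. Math. 84 (1962): §4.
* [Serre1979] J.-P. Serre, *Local Fields*, GTM 67 (1979): Ch. III §6 Prop. 12 (ramified quadratic extensions: valuation of `α − ρα`).
* [Flicker1998UnitaryFL] Y. Z. Flicker, *Elementary proof of the fundamental lemma for a unitary group*, Canad. J. Math. 50 (1998): Prop. 7 p. 84.
-/

set_option autoImplicit false

noncomputable section
namespace Summit.HodgeConjecture.HodgeConjecture.Cruxes.H413.F0P3cDyRamLevelsCensusCutoffCMRamM

open MeasureTheory Measure NumberField IsDedekindDomain Topology Filter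
open Literature.NumberTheory.Automorphic Literature.NumberTheory.Automorphic.UnitaryGroup Literature.NumberTheory.Automorphic.IntegralReduction
open Literature.NumberTheory.Rogawski1990 Literature.NumberTheory.GaloisRepresentations
open Literature.NumberTheory.Automorphic.UnitaryThreeFourFrame
open scoped Matrix MatrixGroups Classical Valued WithZero
open Literature.NumberTheory.Automorphic.UnitaryLatticeTree Literature.NumberTheory.Automorphic.HermitianLattice
open Literature.NumberTheory.Automorphic.EllipticPlaneAsFieldLine
open Literature.NumberTheory.LocalFields.QuadraticOrder
open Summit.HodgeConjecture.HodgeConjecture.Cruxes.H413.F0P3cDyRamToricCensusDefs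
open Summit.HodgeConjecture.HodgeConjecture.Cruxes.H413.F0P3cDyRamFourFrameCensusDefs (LatticeInLevel)
open Summit.HodgeConjecture.HodgeConjecture.Cruxes.H413.F0P3cDyRamLevelsCensusGuardedCM
open Summit.HodgeConjecture.HodgeConjecture.Cruxes.H413.F0P3cDyRamToricLevelCensusRamMTwoMult (finsum_mem_inter_levelSetDep_eq_ramified)
open Summit.HodgeConjecture.HodgeConjecture.Cruxes.H413.F0P3cDyRamToricLevelCensusRamM (v_sub_map_eq_exp_of_datum)
open Summit.HodgeConjecture.HodgeConjecture.Cruxes.H413.F0P3cDyRamOrderFiltrationRange (isOrd_pow_iff_le)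
open Summit.HodgeConjecture.HodgeConjecture.Cruxes.H413.F0P3cDyRamJointProfileCensusGuardLetter (v_twist_depth_sub_twist_sq_eq)
open Summit.HodgeConjecture.HodgeConjecture.Cruxes.H413.F0P3cDyRamJointProfileCensusAxisTables (sum_ite_isOrd₃_eq_sum_range)
open Summit.HodgeConjecture.HodgeConjecture.Cruxes.H413.F0P3cDyRamJointProfileCensusIndicatorLetter (isOrd_pow_inv_mul_sub_one_iff_le)
open Summit.HodgeConjecture.HodgeConjecture.Cruxes.H413.F0P3cDyRamJointProfileCensusCutoff (guard_iff_cutoff_ramM add_sub_two_sub_map_eq)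

/-! ## §0 The three-clause indicator when the trace token is deep — lane-free form (finite token by witness) -/

section Deep

variable {K : Type} [Field K] [Valued K ℤᵐ⁰] {ρ : K →+* K} {α ϖE : K}

/-- **(T5-P-axis)♯′ THE THREE-CLAUSE INDICATOR TRUNCATES AT `jλ − a` WHEN THE TRACE TOKEN IS DEEP — lane-free.**  As ★ p860083 §0, but the finite token of a non-zero
`lam + ρlam − 2` is a WITNESS hypothesis `hxpow` (any uniformiser letter), the case `lam + ρlam = 2` again automatic. [cite: Kottwitz1986BaseChangeUnits, §1 pp. 240–241] [cite: Flicker1998UnitaryFL, Prop. 7 p. 84] -/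
theorem sum_ite_isOrd₃_eq_sum_range_of_deep' {N : Type*} [AddCommMonoid N] (hα : ρ α ≠ α)
    (hϖ0 : ϖE ≠ 0) (hϖ1 : Valued.v ϖE < 1)
    {lam : K} (hlam1 : Valued.v lam ≤ 1) {jl : ℕ} (hjl : Valued.v (lam - ρ lam) = Valued.v ϖE ^ jl * Valued.v (α - ρ α))
    {c : K} (hρc : ρ c = c) {a : ℕ} (hc : Valued.v c = Valued.v ϖE ^ a) (hlev : Valued.v (lam - 1) ≤ Valued.v c) (hajl : a ≤ jl)
    {c' : K} (hρc' : ρ c' = c') {b : ℕ} (hc' : Valued.v c' = Valued.v ϖE ^ b) (hlev2 : Valued.v ((lam - 1) * (lam - 1)) ≤ Valued.v c')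
    (hxpow : lam + ρ lam - 2 ≠ 0 → ∃ n : ℕ, Valued.v (lam + ρ lam - 2) = Valued.v ϖE ^ n)
    (hdeep : Valued.v (lam + ρ lam - 2) ≤ Valued.v ϖE ^ (b - a)) {J : ℕ} (hJ : jl ≤ J) (g : ℕ → N) :
    ∑ j ∈ Finset.range (J + 1),
        (if IsOrd ρ α (ϖE ^ j) lam ∧ IsOrd ρ α (ϖE ^ j) (c⁻¹ * (lam - 1)) ∧ IsOrd ρ α (ϖE ^ j) (c'⁻¹ * ((lam - 1) * (lam - 1))) then g j else 0) =
      ∑ j ∈ Finset.range (jl - a + 1), g j := by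
  by_cases h0 : lam + ρ lam - 2 = 0
  · -- the square clause is automatic: `c'⁻¹(lam − 1)²` is `ρ`-fixed and integral
    have hvc : Valued.v c' ≠ 0 := by rw [hc']; exact pow_ne_zero _ ((Valuation.ne_zero_iff _).2 hϖ0)
    have hc0 : c' ≠ 0 := fun h' => hvc (by rw [h', map_zero])
    have hρlam : ρ lam = 2 - lam := by linear_combination h0
    have hfix : ρ (c'⁻¹ * ((lam - 1) * (lam - 1))) = c'⁻¹ * ((lam - 1) * (lam - 1)) := by
      rw [map_mul, map_inv₀, hρc', map_mul, map_sub, map_one, hρlam]; ring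
    have hint : Valued.v (c'⁻¹ * ((lam - 1) * (lam - 1))) ≤ 1 := by
      rw [map_mul, map_inv₀]; exact inv_mul_le_one_of_le₀ hlev2 zero_le
    have h3 : ∀ j, IsOrd ρ α (ϖE ^ j) (c'⁻¹ * ((lam - 1) * (lam - 1))) := fun j =>
      ⟨hint, by rw [hfix, sub_self, map_zero]; exact zero_le⟩
    have hiff : ∀ j, (IsOrd ρ α (ϖE ^ j) lam ∧ IsOrd ρ α (ϖE ^ j) (c⁻¹ * (lam - 1)) ∧ IsOrd ρ α (ϖE ^ j) (c'⁻¹ * ((lam - 1) * (lam - 1)))) ↔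
        j ≤ jl - a := fun j => by
      rw [isOrd_pow_iff_le hα hϖ0 hϖ1 hlam1 hjl j, isOrd_pow_inv_mul_sub_one_iff_le hα hϖ0 hϖ1 hρc hc hlev hjl hajl j, and_iff_left (h3 j)]
      omega
    simp_rw [hiff]
    rw [← Finset.sum_filter]
    congr 1
    ext j
    simp only [Finset.mem_filter, Finset.mem_range]
    omega
  · -- the trace token is finite: `|lam + ρlam − 2| = |ϖE|^n` with `b − a ≤ n`
    obtain ⟨n, hn⟩ := hxpow h0
    have hban : b - a ≤ n := by
      have h := hdeep
      rw [hn] at h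
      exact (pow_le_pow_iff_right_of_lt_one₀ (zero_lt_iff.2 ((Valuation.ne_zero_iff _).2 hϖ0)) hϖ1).1 h
    rw [sum_ite_isOrd₃_eq_sum_range hα hϖ0 hϖ1 hlam1 hjl hρc hc hlev hajl hρc' hc' hlev2 hn (by omega) hJ, min_eq_left (by omega)]

end Deep

/-! ## §1 The hyperbolic literal -/

/-- **(C2-lev-cutoff-CM-RamM), HYPERBOLIC LITERAL, M∕E RAMIFIED (type RamM), `m₁ ≤ m₂`.**  ★ p859485 §1's binders VERBATIM (universe-`0` `M`) with `hcell :=` ★ p858944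
under the ramified datum on `M`, `|jEϖ| = exp(−2)` and power-form multiplier tokens, plus the tokens `jl, kν`, the deep trace token and the level letters; conclusion:
axis rows `j ≤ jl − a` + cone cells of `μ₁` behind the guard `j + b′ ≤ m₂ ∨ 2(j + b′) + kν ≤ 2m₂ + 2jl`. [cite: Serre1979, Ch. III §6 Prop. 12] [cite: Kottwitz1986BaseChangeUnits, §1 pp. 240–241] [cite: Rogawski1990, §4.9 Prop. 4.9.1 (a)(b) pp. 54–55] [cite: Jacobowitz1962, §4] [cite: Flicker1998UnitaryFL, Prop. 7 p. 84] -/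
theorem ncard_typeZero_fixed_endoGL_levels_eq_cutoff_ramM (L : Type) [Field L] [NumberField L] [IsCMField L]
    {v : HeightOneSpectrum (𝓞 ↥(maximalRealSubfield L))} (w : UnitaryGroup.PlacesOver L v)
    (hw : IsCMField.complexConj L • w.1 = w.1) {ϖ : (w.1.adicCompletion L)} (hϖ : Valued.v ϖ = WithZero.exp (-1 : ℤ))
    {M : Type} [Field M] [Valued M ℤᵐ⁰] {ρ Θ : M →+* M} {α : M} (jE : (w.1.adicCompletion L) →+* M)
    (hρρ : ∀ x, ρ (ρ x) = x) (hvρ : ∀ x, Valued.v (ρ x) = Valued.v x) (hα : ρ α ≠ α) (hα1 : Valued.v α ≤ 1)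
    (hint : ∀ z : M, Valued.v z ≤ 1 → Valued.v ((z - ρ z) / (α - ρ α)) ≤ 1)
    (hΘΘ : ∀ x, Θ (Θ x) = x) (hΘρ : ∀ x, Θ (ρ x) = ρ (Θ x)) (hvΘ : ∀ x, Valued.v (Θ x) = Valued.v x)
    (hΘj : ∀ x, Θ (jE x) = jE ((galAdicCompletionMap (L := L) (IsCMField.complexConj L) hw) x))
    (hjv : ∀ c, Valued.v (jE c) ≤ 1 ↔ Valued.v c ≤ 1) (hjfix : ∀ z, ρ z = z ↔ ∃ c, jE c = z)
    (hjpow : ∀ (t : (w.1.adicCompletion L)) (n : ℤ), Valued.v (jE t) = Valued.v (jE ϖ) ^ n ↔ Valued.v t = Valued.v ϖ ^ n)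
    (hEval : ∀ c : M, ρ c = c → c ≠ 0 → Valued.v c ≤ 1 → ∃ n : ℕ, Valued.v c = Valued.v (jE ϖ) ^ n)
    (hϖmax : ∀ t : M, ρ t = t → Valued.v t < 1 → Valued.v t ≤ Valued.v (jE ϖ))
    (φ : (Fin 2 → (w.1.adicCompletion L)) →+ M) (hφs : ∀ (c : (w.1.adicCompletion L)) (x : Fin 2 → (w.1.adicCompletion L)), φ (c • x) = jE c * φ x)
    (hφi : Function.Injective φ) (hφo : Function.Surjective φ)
    (γ₂ : GL (Fin 2) (w.1.adicCompletion L)) {lam h : M} (hφγ : ∀ x, φ ((γ₂ : Matrix (Fin 2) (Fin 2) (w.1.adicCompletion L)).mulVec x) = lam * φ x) (hlam : Valued.v lam = 1)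
    (hΘh : Θ h = h) (hh : h ≠ 0)
    (hform : ∀ x y, jE (pairing (galAdicCompletionMap (L := L) (IsCMField.complexConj L) hw) (placeForm (Matrix.of fun i j : Fin 2 => if i.val + j.val + 1 = 2 then (1 : L) else 0) w.1) x y) =
      h * Θ (φ x) * φ y + ρ (h * Θ (φ x) * φ y))
    (u : GL (Fin 1) (w.1.adicCompletion L))
    (hΓ : endoGL (γ₂, u) ∈ unitaryGroupOfForm (galAdicCompletionMap (L := L) (IsCMField.complexConj L) hw) (placeForm (Matrix.of fun i j : Fin 3 => if i.val + j.val + 1 = 3 then (1 : L) else 0) w.1))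
    (hu : Valued.v ((u : Matrix (Fin 1) (Fin 1) (w.1.adicCompletion L)) 0 0) = 1) (a b : ℕ)
    (huc : Valued.v ((u : Matrix (Fin 1) (Fin 1) (w.1.adicCompletion L)) 0 0 - 1) ≤ Valued.v ϖ ^ a)
    (huc2 : Valued.v (((u : Matrix (Fin 1) (Fin 1) (w.1.adicCompletion L)) 0 0 - 1) ^ 2) ≤ Valued.v ϖ ^ b) {R : ℕ}
    (hfinF : {M₃ : Submodule (Valued.integer (w.1.adicCompletion L)) (Fin 3 → (w.1.adicCompletion L)) |
      IsVertexLattice (galAdicCompletionMap (L := L) (IsCMField.complexConj L) hw) ϖ ((StdForm.antidiagonal 3).over (w.1.adicCompletion L)) 0 M₃ ∧ mapGL (endoGL (γ₂, u)) M₃ = M₃}.Finite)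
    (hR : ∀ M₃ : Submodule (Valued.integer (w.1.adicCompletion L)) (Fin 3 → (w.1.adicCompletion L)),
      IsVertexLattice (galAdicCompletionMap (L := L) (IsCMField.complexConj L) hw) ϖ ((StdForm.antidiagonal 3).over (w.1.adicCompletion L)) 0 M₃ →
      mapGL (endoGL (γ₂, u)) M₃ = M₃ → ∀ b' : ℕ, (∀ c : (w.1.adicCompletion L), (Pi.single 1 c : Fin 3 → (w.1.adicCompletion L)) ∈ M₃ ↔ Valued.v c ≤ Valued.v ϖ ^ b') → b' ≤ R)
    {J : ℕ} (hJ : ¬ IsOrd ρ α (jE ϖ ^ (J + 1)) lam) (hfinLS : ∀ j a', (levelSet ρ Θ α (jE ϖ) h j a').Finite)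
    (f : ℕ → ℕ → AddSubgroup M → ℕ)
    (hf : ∀ (b' j : ℕ) (Λ : AddSubgroup M) (x₀ : M) (r : (w.1.adicCompletion L)), 1 ≤ b' → x₀ ≠ 0 →
      (∀ x, x ∈ Λ ↔ ∃ z, IsOrd ρ α (jE ϖ ^ j) z ∧ x = x₀ * z) →
      IsOrd ρ α (jE ϖ ^ j) (dualGen ρ Θ α (jE ϖ ^ j) h x₀) → ¬ IsOrd ρ α (jE ϖ ^ j) (dualGen ρ Θ α (jE ϖ ^ j) h x₀ / jE ϖ) →
      Valued.v (dualGen ρ Θ α (jE ϖ ^ j) h x₀) = Valued.v (jE ϖ) ^ b' →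
      (∀ b'', (∀ x ∈ Λ, Valued.v (h * Θ x * b'' + ρ (h * Θ x * b'')) ≤ 1) → (lam - jE ((u : Matrix (Fin 1) (Fin 1) (w.1.adicCompletion L)) 0 0)) * b'' ∈ Λ) →
      IsOrd ρ α (jE ϖ ^ j) lam → jE r = glueUnit ρ Θ α (jE ϖ ^ j) h (jE ϖ) (jE 1) x₀ b' →
      f b' j Λ = Nat.card {x : 𝒪[(w.1.adicCompletion L)] ⧸ 𝓂[(w.1.adicCompletion L)] ^ (2 * b') //
        ∃ u' : 𝒪[(w.1.adicCompletion L)], Ideal.Quotient.mk (𝓂[(w.1.adicCompletion L)] ^ (2 * b')) u' = x ∧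
          Valued.v ((u' : (w.1.adicCompletion L)) * (galAdicCompletionMap (L := L) (IsCMField.complexConj L) hw) u' - r) ≤ Valued.v (ϖ ^ (2 * b'))})
    {dρ tρ : ℕ} (hDρ : IsRamifiedQuadraticDatum ρ α dρ tρ) (hϖM : Valued.v (jE ϖ) = WithZero.exp (-2 : ℤ)) {m₁ m₂ : ℕ}
    (hm₁ : Valued.v ((jE ϖ ^ a)⁻¹ * (lam - jE ((u : Matrix (Fin 1) (Fin 1) (w.1.adicCompletion L)) 0 0))) = Valued.v (jE ϖ) ^ m₁)
    (hm₂ : Valued.v ((jE ϖ ^ b)⁻¹ * ((lam - 1) * (lam - 1) - jE (((u : Matrix (Fin 1) (Fin 1) (w.1.adicCompletion L)) 0 0 - 1) ^ 2))) = Valued.v (jE ϖ) ^ m₂) (hle : m₁ ≤ m₂)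
    {jl : ℕ} (hjl : Valued.v (lam - ρ lam) = Valued.v (jE ϖ) ^ jl * Valued.v (α - ρ α))
    (hlev : Valued.v (lam - 1) ≤ Valued.v (jE ϖ ^ a)) (hajl : a ≤ jl) (hlev2 : Valued.v ((lam - 1) * (lam - 1)) ≤ Valued.v (jE ϖ ^ b))
    (hdeep : Valued.v (lam + ρ lam - 2) ≤ Valued.v (jE ϖ) ^ (b - a))
    {kν : ℕ} (hkν : Valued.v (lam + jE ((u : Matrix (Fin 1) (Fin 1) (w.1.adicCompletion L)) 0 0) - 2) = WithZero.exp (-(kν : ℤ))) :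
    {M₃ : Submodule (Valued.integer (w.1.adicCompletion L)) (Fin 3 → (w.1.adicCompletion L)) |
        IsVertexLattice (galAdicCompletionMap (L := L) (IsCMField.complexConj L) hw) ϖ ((StdForm.antidiagonal 3).over (w.1.adicCompletion L)) 0 M₃ ∧ mapGL (endoGL (γ₂, u)) M₃ = M₃ ∧
          (LatticeInLevel ϖ a (((endoGL (γ₂, u) : GL (Fin 3) (w.1.adicCompletion L)) : Matrix (Fin 3) (Fin 3) (w.1.adicCompletion L)) - 1) M₃ ∧
            LatticeInLevel ϖ b ((((endoGL (γ₂, u) : GL (Fin 3) (w.1.adicCompletion L)) : Matrix (Fin 3) (Fin 3) (w.1.adicCompletion L)) - 1) *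
              (((endoGL (γ₂, u) : GL (Fin 3) (w.1.adicCompletion L)) : Matrix (Fin 3) (Fin 3) (w.1.adicCompletion L)) - 1)) M₃)}.ncard =
      (∑ j ∈ Finset.range (jl - a + 1), (levelSet ρ Θ α (jE ϖ) h j 0).ncard) +
        ∑ b' ∈ Finset.Icc 1 R, ∑ j ∈ Finset.range (jl - a + 1),
          (if j + b' ≤ m₂ ∨ 2 * (j + b') + kν ≤ 2 * m₂ + 2 * jl then
            ∑ᶠ Λ ∈ levelSetDep ρ Θ α (jE ϖ) h j b' ((jE ϖ ^ a)⁻¹ * (lam - jE ((u : Matrix (Fin 1) (Fin 1) (w.1.adicCompletion L)) 0 0))), f b' j Λ else 0) := by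
  have hϖv : Valued.v (jE ϖ) ≠ 0 := by rw [hϖM]; exact WithZero.exp_ne_zero
  have hϖE0 : jE ϖ ≠ 0 := fun h0 => by rw [h0, map_zero] at hϖv; exact hϖv rfl
  have hϖE1 : Valued.v (jE ϖ) < 1 := by rw [hϖM, ← WithZero.exp_zero, WithZero.exp_lt_exp]; norm_num
  have hρϖ : ρ (jE ϖ) = jE ϖ := (hjfix _).2 ⟨ϖ, rfl⟩
  have hρc : ρ (jE ϖ ^ a) = jE ϖ ^ a := by rw [map_pow, hρϖ]
  have hρc' : ρ (jE ϖ ^ b) = jE ϖ ^ b := by rw [map_pow, hρϖ]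
  have hρu : ρ (jE ((u : Matrix (Fin 1) (Fin 1) (w.1.adicCompletion L)) 0 0)) = jE ((u : Matrix (Fin 1) (Fin 1) (w.1.adicCompletion L)) 0 0) := (hjfix _).2 ⟨_, rfl⟩
  have hca : Valued.v (jE ϖ ^ a) = Valued.v (jE ϖ) ^ a := map_pow _ _ _
  have hcb : Valued.v (jE ϖ ^ b) = Valued.v (jE ϖ) ^ b := map_pow _ _ _
  have hϖ0 : ϖ ≠ 0 := fun h0 => hϖE0 (by rw [h0, map_zero])
  have hcE0 : jE (ϖ ^ a) ≠ 0 := (map_ne_zero jE).2 (pow_ne_zero _ hϖ0)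
  have hc'E0 : jE (ϖ ^ b) ≠ 0 := (map_ne_zero jE).2 (pow_ne_zero _ hϖ0)
  have hjlJ : jl ≤ J := by
    have h' := (isOrd_pow_iff_le hα hϖE0 hϖE1 hlam.le hjl (J + 1)).not.1 hJ
    omega
  have hμ0 : lam - jE ((u : Matrix (Fin 1) (Fin 1) (w.1.adicCompletion L)) 0 0) ≠ 0 := by
    intro h0
    have h1 := hm₁
    rw [h0, mul_zero, map_zero] at h1
    exact pow_ne_zero m₁ hϖv h1.symm
  have hν0 : lam + jE ((u : Matrix (Fin 1) (Fin 1) (w.1.adicCompletion L)) 0 0) - 2 ≠ 0 := fun h0 => by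
    rw [h0, map_zero] at hkν; exact WithZero.exp_ne_zero hkν.symm
  have h21 : Valued.v (2 : M) ≤ 1 := by
    rw [show (2 : M) = 1 + 1 by norm_num]; exact (Valuation.map_add _ _ _).trans (by rw [Valuation.map_one, max_self])
  have hxpow : lam + ρ lam - 2 ≠ 0 → ∃ n : ℕ, Valued.v (lam + ρ lam - 2) = Valued.v (jE ϖ) ^ n := fun hx =>
    hEval _ (by rw [map_sub, map_add, hρρ, map_ofNat]; ring) hx
      ((Valuation.map_sub _ _ _).trans (max_le ((Valuation.map_add _ _ _).trans (max_le hlam.le (by rw [hvρ]; exact hlam.le))) h21))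
  rw [ncard_typeZero_fixed_endoGL_levels_eq_guardedForm L w hw hϖ jE hρρ hvρ hα hα1 hint hΘΘ hΘρ hvΘ hΘj hjv hjfix hjpow hEval hϖmax φ hφs hφi hφo γ₂
    hφγ hlam hΘh hh hform u hΓ hu a b huc huc2 hfinF hR hJ hfinLS f hf _
    (fun j b' => finsum_mem_inter_levelSetDep_eq_ramified hDρ hΘΘ hΘρ hvΘ hρϖ hϖM hh hm₁ hm₂ hle j b' (f b' j))]
  congr 1
  · exact sum_ite_isOrd₃_eq_sum_range_of_deep' hα hϖE0 hϖE1 hlam.le hjl hρc hca hlev hajl hρc' hcb hlev2 hxpow hdeep hjlJ _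
  · refine Finset.sum_congr rfl fun b' _ => ?_
    rw [sum_ite_isOrd₃_eq_sum_range_of_deep' hα hϖE0 hϖE1 hlam.le hjl hρc hca hlev hajl hρc' hcb hlev2 hxpow hdeep hjlJ]
    refine Finset.sum_congr rfl fun j _ => ?_
    have hguard : (j + b' ≤ m₂ ∨ Valued.v (ρ ((jE ϖ ^ a)⁻¹ * (lam - jE ((u : Matrix (Fin 1) (Fin 1) (w.1.adicCompletion L)) 0 0))) / ((jE ϖ ^ a)⁻¹ * (lam - jE ((u : Matrix (Fin 1) (Fin 1) (w.1.adicCompletion L)) 0 0))) -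
        ρ ((jE ϖ ^ b)⁻¹ * ((lam - 1) * (lam - 1) - jE ((((u : Matrix (Fin 1) (Fin 1) (w.1.adicCompletion L)) 0 0) - 1) ^ 2))) / ((jE ϖ ^ b)⁻¹ * ((lam - 1) * (lam - 1) - jE ((((u : Matrix (Fin 1) (Fin 1) (w.1.adicCompletion L)) 0 0) - 1) ^ 2)))) ≤
          WithZero.exp (2 * (m₂ : ℤ) - 2 * b' - 2 * j - dρ)) ↔ (j + b' ≤ m₂ ∨ 2 * (j + b') + kν ≤ 2 * m₂ + 2 * jl) := by
      rw [show jE ϖ ^ a = jE (ϖ ^ a) from (map_pow jE ϖ a).symm, show jE ϖ ^ b = jE (ϖ ^ b) from (map_pow jE ϖ b).symm,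
        v_twist_depth_sub_twist_sq_eq hvρ jE hcE0 hc'E0 (by rw [map_pow, hρc]) (by rw [map_pow, hρc']) hμ0 hν0, add_sub_two_sub_map_eq hρu]
      exact guard_iff_cutoff_ramM hϖM (v_sub_map_eq_exp_of_datum hDρ) hjl hkν j b' m₂
    by_cases hcut : j + b' ≤ m₂ ∨ 2 * (j + b') + kν ≤ 2 * m₂ + 2 * jl
    · rw [if_pos (hguard.2 hcut), if_pos hcut]
    · rw [if_neg (fun h' => hcut (hguard.1 h')), if_neg hcut]

/-! ## §2 The anisotropic literal -/

/-- **(C2-lev-cutoff-CM-RamM), ANISOTROPIC LITERAL `P₁·endoGL (γ₁, u)·P₁⁻¹`, M∕E RAMIFIED, `m₁ ≤ m₂`.**  ★ p859485 §2's binders VERBATIM (universe-`0` `M`) with `hcell :=` ★ p858944,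
plus the ramified datum, the tokens `jl, kν`, the deep trace token and the level letters; conclusion in the RamM cutoff currency. [cite: Serre1979, Ch. III §6 Prop. 12]
[cite: Kottwitz1986BaseChangeUnits, §1 pp. 240–241] [cite: Rogawski1990, §4.9 Prop. 4.9.1 (a)(b) pp. 54–55] [cite: Jacobowitz1962, §4] [cite: Flicker1998UnitaryFL, Prop. 7 p. 84] -/
theorem ncard_typeZero_fixed_conj_endoGL_levels_eq_cutoff_ramM (L : Type) [Field L] [NumberField L] [IsCMField L]
    {v : HeightOneSpectrum (𝓞 ↥(maximalRealSubfield L))} (w : UnitaryGroup.PlacesOver L v)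
    (hw : IsCMField.complexConj L • w.1 = w.1) {ϖ : (w.1.adicCompletion L)} (hϖ : Valued.v ϖ = WithZero.exp (-1 : ℤ))
    {M : Type} [Field M] [Valued M ℤᵐ⁰] {ρ Θ : M →+* M} {α : M} (jE : (w.1.adicCompletion L) →+* M)
    (hρρ : ∀ x, ρ (ρ x) = x) (hvρ : ∀ x, Valued.v (ρ x) = Valued.v x) (hα : ρ α ≠ α) (hα1 : Valued.v α ≤ 1)
    (hint : ∀ z : M, Valued.v z ≤ 1 → Valued.v ((z - ρ z) / (α - ρ α)) ≤ 1)
    (hΘΘ : ∀ x, Θ (Θ x) = x) (hΘρ : ∀ x, Θ (ρ x) = ρ (Θ x)) (hvΘ : ∀ x, Valued.v (Θ x) = Valued.v x)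
    (hΘj : ∀ x, Θ (jE x) = jE ((galAdicCompletionMap (L := L) (IsCMField.complexConj L) hw) x))
    (hjv : ∀ c, Valued.v (jE c) ≤ 1 ↔ Valued.v c ≤ 1) (hjfix : ∀ z, ρ z = z ↔ ∃ c, jE c = z)
    (hjpow : ∀ (t : (w.1.adicCompletion L)) (n : ℤ), Valued.v (jE t) = Valued.v (jE ϖ) ^ n ↔ Valued.v t = Valued.v ϖ ^ n)
    (hEval : ∀ c : M, ρ c = c → c ≠ 0 → Valued.v c ≤ 1 → ∃ n : ℕ, Valued.v c = Valued.v (jE ϖ) ^ n)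
    (hϖmax : ∀ t : M, ρ t = t → Valued.v t < 1 → Valued.v t ≤ Valued.v (jE ϖ))
    (P₁ : GL (Fin 3) (w.1.adicCompletion L)) (dg : Fin 2 → (w.1.adicCompletion L)) (η : (w.1.adicCompletion L))
    (γ₁ : GL (Fin 2) (w.1.adicCompletion L)) (u : GL (Fin 1) (w.1.adicCompletion L))
    (hfc : formCongr (galAdicCompletionMap (L := L) (IsCMField.complexConj L) hw) P₁ (placeForm (Matrix.of fun i j : Fin 3 => if i.val + j.val + 1 = 3 then (1 : L) else 0) w.1) =
      (!![(Matrix.diagonal dg) 0 0, 0, (Matrix.diagonal dg) 0 1; 0, η, 0; (Matrix.diagonal dg) 1 0, 0, (Matrix.diagonal dg) 1 1] : Matrix (Fin 3) (Fin 3) (w.1.adicCompletion L)))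
    (hdg1 : ∀ i, Valued.v (dg i) = 1) (hdgσ : ∀ i, (galAdicCompletionMap (L := L) (IsCMField.complexConj L) hw) (dg i) = dg i)
    (hησ : (galAdicCompletionMap (L := L) (IsCMField.complexConj L) hw) η = η) (hη1 : Valued.v η = 1)
    (hmem : P₁ * endoGL (γ₁, u) * P₁⁻¹ ∈
      unitaryGroupOfForm (galAdicCompletionMap (L := L) (IsCMField.complexConj L) hw) (placeForm (Matrix.of fun i j : Fin 3 => if i.val + j.val + 1 = 3 then (1 : L) else 0) w.1))
    (hu : Valued.v ((u : Matrix (Fin 1) (Fin 1) (w.1.adicCompletion L)) 0 0) = 1) (a b : ℕ)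
    (huc : Valued.v ((u : Matrix (Fin 1) (Fin 1) (w.1.adicCompletion L)) 0 0 - 1) ≤ Valued.v ϖ ^ a)
    (huc2 : Valued.v (((u : Matrix (Fin 1) (Fin 1) (w.1.adicCompletion L)) 0 0 - 1) ^ 2) ≤ Valued.v ϖ ^ b)
    (φ : (Fin 2 → (w.1.adicCompletion L)) →+ M) (hφs : ∀ (c : (w.1.adicCompletion L)) (x : Fin 2 → (w.1.adicCompletion L)), φ (c • x) = jE c * φ x)
    (hφi : Function.Injective φ) (hφo : Function.Surjective φ)
    {lam h : M} (hφγ : ∀ x, φ ((γ₁ : Matrix (Fin 2) (Fin 2) (w.1.adicCompletion L)).mulVec x) = lam * φ x) (hlam : Valued.v lam = 1)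
    (hΘh : Θ h = h) (hh : h ≠ 0)
    (hform : ∀ x y, jE (pairing (galAdicCompletionMap (L := L) (IsCMField.complexConj L) hw) (Matrix.diagonal dg) x y) = h * Θ (φ x) * φ y + ρ (h * Θ (φ x) * φ y))
    {R : ℕ}
    (hfinF : {M₃ : Submodule (Valued.integer (w.1.adicCompletion L)) (Fin 3 → (w.1.adicCompletion L)) |
      IsSelfDualLattice (galAdicCompletionMap (L := L) (IsCMField.complexConj L) hw) ϖ
        (!![(Matrix.diagonal dg) 0 0, 0, (Matrix.diagonal dg) 0 1; 0, η, 0; (Matrix.diagonal dg) 1 0, 0, (Matrix.diagonal dg) 1 1] : Matrix (Fin 3) (Fin 3) (w.1.adicCompletion L)) M₃ ∧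
      mapGL (endoGL (γ₁, u)) M₃ = M₃}.Finite)
    (hR : ∀ M₃ : Submodule (Valued.integer (w.1.adicCompletion L)) (Fin 3 → (w.1.adicCompletion L)),
      IsSelfDualLattice (galAdicCompletionMap (L := L) (IsCMField.complexConj L) hw) ϖ
        (!![(Matrix.diagonal dg) 0 0, 0, (Matrix.diagonal dg) 0 1; 0, η, 0; (Matrix.diagonal dg) 1 0, 0, (Matrix.diagonal dg) 1 1] : Matrix (Fin 3) (Fin 3) (w.1.adicCompletion L)) M₃ →
      mapGL (endoGL (γ₁, u)) M₃ = M₃ → ∀ b' : ℕ, (∀ c : (w.1.adicCompletion L), (Pi.single 1 c : Fin 3 → (w.1.adicCompletion L)) ∈ M₃ ↔ Valued.v c ≤ Valued.v ϖ ^ b') → b' ≤ R)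
    {J : ℕ} (hJ : ¬ IsOrd ρ α (jE ϖ ^ (J + 1)) lam) (hfinLS : ∀ j a', (levelSet ρ Θ α (jE ϖ) h j a').Finite)
    (f : ℕ → ℕ → AddSubgroup M → ℕ)
    (hf : ∀ (b' j : ℕ) (Λ : AddSubgroup M) (x₀ : M) (r : (w.1.adicCompletion L)), 1 ≤ b' → x₀ ≠ 0 →
      (∀ x, x ∈ Λ ↔ ∃ z, IsOrd ρ α (jE ϖ ^ j) z ∧ x = x₀ * z) →
      IsOrd ρ α (jE ϖ ^ j) (dualGen ρ Θ α (jE ϖ ^ j) h x₀) → ¬ IsOrd ρ α (jE ϖ ^ j) (dualGen ρ Θ α (jE ϖ ^ j) h x₀ / jE ϖ) →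
      Valued.v (dualGen ρ Θ α (jE ϖ ^ j) h x₀) = Valued.v (jE ϖ) ^ b' →
      (∀ b'', (∀ x ∈ Λ, Valued.v (h * Θ x * b'' + ρ (h * Θ x * b'')) ≤ 1) → (lam - jE ((u : Matrix (Fin 1) (Fin 1) (w.1.adicCompletion L)) 0 0)) * b'' ∈ Λ) →
      IsOrd ρ α (jE ϖ ^ j) lam → jE r = glueUnit ρ Θ α (jE ϖ ^ j) h (jE ϖ) (jE η) x₀ b' →
      f b' j Λ = Nat.card {x : 𝒪[(w.1.adicCompletion L)] ⧸ 𝓂[(w.1.adicCompletion L)] ^ (2 * b') //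
        ∃ u' : 𝒪[(w.1.adicCompletion L)], Ideal.Quotient.mk (𝓂[(w.1.adicCompletion L)] ^ (2 * b')) u' = x ∧
          Valued.v ((u' : (w.1.adicCompletion L)) * (galAdicCompletionMap (L := L) (IsCMField.complexConj L) hw) u' - r) ≤ Valued.v (ϖ ^ (2 * b'))})
    {dρ tρ : ℕ} (hDρ : IsRamifiedQuadraticDatum ρ α dρ tρ) (hϖM : Valued.v (jE ϖ) = WithZero.exp (-2 : ℤ)) {m₁ m₂ : ℕ}
    (hm₁ : Valued.v ((jE ϖ ^ a)⁻¹ * (lam - jE ((u : Matrix (Fin 1) (Fin 1) (w.1.adicCompletion L)) 0 0))) = Valued.v (jE ϖ) ^ m₁)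
    (hm₂ : Valued.v ((jE ϖ ^ b)⁻¹ * ((lam - 1) * (lam - 1) - jE ((((u : Matrix (Fin 1) (Fin 1) (w.1.adicCompletion L)) 0 0) - 1) ^ 2))) = Valued.v (jE ϖ) ^ m₂) (hle : m₁ ≤ m₂)
    {jl : ℕ} (hjl : Valued.v (lam - ρ lam) = Valued.v (jE ϖ) ^ jl * Valued.v (α - ρ α))
    (hlev : Valued.v (lam - 1) ≤ Valued.v (jE ϖ ^ a)) (hajl : a ≤ jl) (hlev2 : Valued.v ((lam - 1) * (lam - 1)) ≤ Valued.v (jE ϖ ^ b))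
    (hdeep : Valued.v (lam + ρ lam - 2) ≤ Valued.v (jE ϖ) ^ (b - a))
    {kν : ℕ} (hkν : Valued.v (lam + jE ((u : Matrix (Fin 1) (Fin 1) (w.1.adicCompletion L)) 0 0) - 2) = WithZero.exp (-(kν : ℤ))) :
    {M₃ : Submodule (Valued.integer (w.1.adicCompletion L)) (Fin 3 → (w.1.adicCompletion L)) |
        IsVertexLattice (galAdicCompletionMap (L := L) (IsCMField.complexConj L) hw) ϖ ((StdForm.antidiagonal 3).over (w.1.adicCompletion L)) 0 M₃ ∧
        mapGL (P₁ * endoGL (γ₁, u) * P₁⁻¹) M₃ = M₃ ∧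
          (LatticeInLevel ϖ a (((P₁ * endoGL (γ₁, u) * P₁⁻¹ : GL (Fin 3) (w.1.adicCompletion L)) : Matrix (Fin 3) (Fin 3) (w.1.adicCompletion L)) - 1) M₃ ∧
            LatticeInLevel ϖ b ((((P₁ * endoGL (γ₁, u) * P₁⁻¹ : GL (Fin 3) (w.1.adicCompletion L)) : Matrix (Fin 3) (Fin 3) (w.1.adicCompletion L)) - 1) *
              (((P₁ * endoGL (γ₁, u) * P₁⁻¹ : GL (Fin 3) (w.1.adicCompletion L)) : Matrix (Fin 3) (Fin 3) (w.1.adicCompletion L)) - 1)) M₃)}.ncard =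
      (∑ j ∈ Finset.range (jl - a + 1), (levelSet ρ Θ α (jE ϖ) h j 0).ncard) +
        ∑ b' ∈ Finset.Icc 1 R, ∑ j ∈ Finset.range (jl - a + 1),
          (if j + b' ≤ m₂ ∨ 2 * (j + b') + kν ≤ 2 * m₂ + 2 * jl then
            ∑ᶠ Λ ∈ levelSetDep ρ Θ α (jE ϖ) h j b' ((jE ϖ ^ a)⁻¹ * (lam - jE ((u : Matrix (Fin 1) (Fin 1) (w.1.adicCompletion L)) 0 0))), f b' j Λ else 0) := by
  have hϖv : Valued.v (jE ϖ) ≠ 0 := by rw [hϖM]; exact WithZero.exp_ne_zero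
  have hϖE0 : jE ϖ ≠ 0 := fun h0 => by rw [h0, map_zero] at hϖv; exact hϖv rfl
  have hϖE1 : Valued.v (jE ϖ) < 1 := by rw [hϖM, ← WithZero.exp_zero, WithZero.exp_lt_exp]; norm_num
  have hρϖ : ρ (jE ϖ) = jE ϖ := (hjfix _).2 ⟨ϖ, rfl⟩
  have hρc : ρ (jE ϖ ^ a) = jE ϖ ^ a := by rw [map_pow, hρϖ]
  have hρc' : ρ (jE ϖ ^ b) = jE ϖ ^ b := by rw [map_pow, hρϖ]
  have hρu : ρ (jE ((u : Matrix (Fin 1) (Fin 1) (w.1.adicCompletion L)) 0 0)) = jE ((u : Matrix (Fin 1) (Fin 1) (w.1.adicCompletion L)) 0 0) := (hjfix _).2 ⟨_, rfl⟩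
  have hca : Valued.v (jE ϖ ^ a) = Valued.v (jE ϖ) ^ a := map_pow _ _ _
  have hcb : Valued.v (jE ϖ ^ b) = Valued.v (jE ϖ) ^ b := map_pow _ _ _
  have hϖ0 : ϖ ≠ 0 := fun h0 => hϖE0 (by rw [h0, map_zero])
  have hcE0 : jE (ϖ ^ a) ≠ 0 := (map_ne_zero jE).2 (pow_ne_zero _ hϖ0)
  have hc'E0 : jE (ϖ ^ b) ≠ 0 := (map_ne_zero jE).2 (pow_ne_zero _ hϖ0)
  have hjlJ : jl ≤ J := by
    have h' := (isOrd_pow_iff_le hα hϖE0 hϖE1 hlam.le hjl (J + 1)).not.1 hJ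
    omega
  have hμ0 : lam - jE ((u : Matrix (Fin 1) (Fin 1) (w.1.adicCompletion L)) 0 0) ≠ 0 := by
    intro h0
    have h1 := hm₁
    rw [h0, mul_zero, map_zero] at h1
    exact pow_ne_zero m₁ hϖv h1.symm
  have hν0 : lam + jE ((u : Matrix (Fin 1) (Fin 1) (w.1.adicCompletion L)) 0 0) - 2 ≠ 0 := fun h0 => by
    rw [h0, map_zero] at hkν; exact WithZero.exp_ne_zero hkν.symm
  have h21 : Valued.v (2 : M) ≤ 1 := by
    rw [show (2 : M) = 1 + 1 by norm_num]; exact (Valuation.map_add _ _ _).trans (by rw [Valuation.map_one, max_self])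
  have hxpow : lam + ρ lam - 2 ≠ 0 → ∃ n : ℕ, Valued.v (lam + ρ lam - 2) = Valued.v (jE ϖ) ^ n := fun hx =>
    hEval _ (by rw [map_sub, map_add, hρρ, map_ofNat]; ring) hx
      ((Valuation.map_sub _ _ _).trans (max_le ((Valuation.map_add _ _ _).trans (max_le hlam.le (by rw [hvρ]; exact hlam.le))) h21))
  rw [ncard_typeZero_fixed_conj_endoGL_levels_eq_guardedForm L w hw hϖ jE hρρ hvρ hα hα1 hint hΘΘ hΘρ hvΘ hΘj hjv hjfix hjpow hEval hϖmax P₁ dg η γ₁ u hfc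
    hdg1 hdgσ hησ hη1 hmem hu a b huc huc2 φ hφs hφi hφo hφγ hlam hΘh hh hform hfinF hR hJ hfinLS f hf _
    (fun j b' => finsum_mem_inter_levelSetDep_eq_ramified hDρ hΘΘ hΘρ hvΘ hρϖ hϖM hh hm₁ hm₂ hle j b' (f b' j))]
  congr 1
  · exact sum_ite_isOrd₃_eq_sum_range_of_deep' hα hϖE0 hϖE1 hlam.le hjl hρc hca hlev hajl hρc' hcb hlev2 hxpow hdeep hjlJ _
  · refine Finset.sum_congr rfl fun b' _ => ?_
    rw [sum_ite_isOrd₃_eq_sum_range_of_deep' hα hϖE0 hϖE1 hlam.le hjl hρc hca hlev hajl hρc' hcb hlev2 hxpow hdeep hjlJ]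
    refine Finset.sum_congr rfl fun j _ => ?_
    have hguard : (j + b' ≤ m₂ ∨ Valued.v (ρ ((jE ϖ ^ a)⁻¹ * (lam - jE ((u : Matrix (Fin 1) (Fin 1) (w.1.adicCompletion L)) 0 0))) / ((jE ϖ ^ a)⁻¹ * (lam - jE ((u : Matrix (Fin 1) (Fin 1) (w.1.adicCompletion L)) 0 0))) -
        ρ ((jE ϖ ^ b)⁻¹ * ((lam - 1) * (lam - 1) - jE ((((u : Matrix (Fin 1) (Fin 1) (w.1.adicCompletion L)) 0 0) - 1) ^ 2))) / ((jE ϖ ^ b)⁻¹ * ((lam - 1) * (lam - 1) - jE ((((u : Matrix (Fin 1) (Fin 1) (w.1.adicCompletion L)) 0 0) - 1) ^ 2)))) ≤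
          WithZero.exp (2 * (m₂ : ℤ) - 2 * b' - 2 * j - dρ)) ↔ (j + b' ≤ m₂ ∨ 2 * (j + b') + kν ≤ 2 * m₂ + 2 * jl) := by
      rw [show jE ϖ ^ a = jE (ϖ ^ a) from (map_pow jE ϖ a).symm, show jE ϖ ^ b = jE (ϖ ^ b) from (map_pow jE ϖ b).symm,
        v_twist_depth_sub_twist_sq_eq hvρ jE hcE0 hc'E0 (by rw [map_pow, hρc]) (by rw [map_pow, hρc']) hμ0 hν0, add_sub_two_sub_map_eq hρu]
      exact guard_iff_cutoff_ramM hϖM (v_sub_map_eq_exp_of_datum hDρ) hjl hkν j b' m₂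
    by_cases hcut : j + b' ≤ m₂ ∨ 2 * (j + b') + kν ≤ 2 * m₂ + 2 * jl
    · rw [if_pos (hguard.2 hcut), if_pos hcut]
    · rw [if_neg (fun h' => hcut (hguard.1 h')), if_neg hcut]

end Summit.HodgeConjecture.HodgeConjecture.Cruxes.H413.F0P3cDyRamLevelsCensusCutoffCMRamM

end
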